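import Literature.MathematicalPhysics.QuantumFieldTheory.Balaban1983to89.B6Partition118KLevelTorusBinders

/-!
# `Balaban1983to89.B6Cover236MultiLevelTorusBlocks` — [B6] THE COVER (2.36) OF THE BLOCK LATTICE `𝔅_T` OF THE TORUS
`T_η` AND ITS PROPOSITION-2.3 BINDERS, for an ARBITRARY nested family (2.1)–(2.2) of domains of the torus: the family
`{h_□}_{□∈𝒟}` read on blocks, `Σ_□ h_□² = 1` on `𝔅_T`, the enlarged cubes `□⁺` with their two-level windows, the finite
overlap `n₀ = 3·2^{d+1}`, the Lipschitz bound of `h_□` and the gap `y ∉ □⁺ ⟹ d_T(y, supp h_□) ≥ m_g·M` IN PRINT'S DISTANCE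
(2.46) OF THE TORUS — the inputs `hover`, `hpf01`, `hph`, `h236`, `hLip`, `hcube`, `hgap` of the cell's Proposition-2.3
assembly `B6Prop23TwoLevel.prop23_assembled_twoLevel` for the expansion (2.86) on `T_η` (file E1 of the torus (2.86)
programme of seat p21; torus twin of `B6Cover236MultiLevelBlocks`; built BY NAME on p38's periodic partition
`B6Partition118KLevelTorus*` and transfers `B6TorusDepthDistance`; no existing module is touched; no fact is minted)

FRAMING (verbatim cell line):
statement-level skeleton of published theorems with citation tags; proofs where landed; nothing here is a claim about the Yang–Mills mass gap

Source under audit (cell pub-balaban / lit-balaban): T. Bałaban, *Propagators and renormalization transformations for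
lattice gauge theories. II*, Commun. Math. Phys. **96** (1984) 223–250 [`Balaban1984PropagatorsII`, "B6"], p. 229 [PDF 7]
((2.36)), p. 231 [PDF 9] ((2.45)–(2.46)), p. 235 [PDF 13] ((2.70)), p. 237 [PDF 15] ((2.82)–(2.85)) — materialised text
`paper:balaban1984-cmp96-propagators-rt-ii` p0007, p0009, p0013, p0015 re-read this generation; T. Bałaban, *Propagators
and renormalization transformations for lattice gauge theories. I*, Commun. Math. Phys. **95** (1984) 17–40
[`Balaban1984PropagatorsI`], (1.118) p. 36 (the profile `h`).  Unit `lit-balaban-p21` (Phase-2 proof seat p21 gen 17),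
HOME `run/shared/lean/pub/lit-balaban/`, free-target protocol G.5-34(d), own lane (B6 fold owner r03, referee ref-4).

## WHAT IS PRINTED (pp. 229, 235, 237–238; quotations AS PRINTED, from the materialised text
`paper:balaban1984-cmp96-propagators-rt-ii` p0007 L17–24, p0013 L25–27, p0015 L26–30, p0016 L6–7; «…» marks OUR elisions,
square brackets OUR glosses; the p. 229 passage checked against the page scan `1984-cmp96-propagators-rt-II-p007`)

p. 229 (p0007 L17–24): «We cover B^j(Λ_j) by a sum of cubes □ of the size 2ML^jη, each cube being a sum of 2^d big blocks
with a center y ∈ Λ_j (more exactly it belongs to the boundary of this set also). Taking these covers for all j from 0 to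
k we get a family 𝒟 of cubes □ of different sizes and such that T_η = ⋃_{□∈𝒟} □. We will identify this family of cubes
with the set of centers of these cubes. We construct also the corresponding family of functions h described in (1.118),
and rescale them to proper scales. They satisfy Σ_{□∈𝒟} h_□² = 1. (2.36)»  p. 235 (p0013 L25–27): «The
approximate inverse can be constructed by taking inverses of the localized operators (Q′G′²Q′*)↾□ and glueing them
together by the decomposition of unity {h_□}.»  p. 237 (p0015 L25–30; formula read on the page scan
`1984-cmp96-propagators-rt-II-p015`, the tilde over `□′` being faint there): «For example let us consider the operator
R_{□,□′}C_{□′}h_{□′} with □ ≠ □′. A kernel of this operator can be estimated as follows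
|(□̃′ − 1)(y)h²_□(y) Σ_{y″∈supp h_{□′}} (L^{j′}η)^d (Q′G′²Q′*)(y, y″)h_{□′}(y″)C_{□′}(y″, y′)h_{□′}(y′)| ≤ … (2.83) where we
have used the fact that y ∉ □̃′, and all the properties of the distance d(·,·).»  p. 238 (p0016 L6–7): «An estimate of
the terms with the commutator is even simpler and gives a factor O(M⁻¹)» [OUR reading: the Lipschitz bound of `h_□` at
the scale `M`].  OUR COMPRESSION of these sentences for this file: the cover `𝒟` with `Σ_□ h_□² = 1` (2.36), the
enlarged cubes `□̃` off which `h_□`-supported kernels are estimated by `d(·,·)` (2.83), and the `O(M⁻¹)` commutator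
(Lipschitz) factor — the three cover inputs of Proposition 2.3's gluing.

## WHAT THIS FILE CERTIFIES (kernel-checked; setting of `B6MultiLevelTorusOperator`)

For every nested family `D : TDomains d ℓ M_h k P R` of domains of the torus (levels `1 … k`, `Ω₁ = T_η`, lattice units,
spatial dimension `d + 1`, `L = ℓ + 1 ≥ 2`, `M = L·M_h`), with the cover `𝒟 = cubes D.toDomains` (the active big blocks of
`B6Cover236MultiLevelBlocks`) and p38's periodic partition `h^T_□` of the SITES of `T_η` (`B6Partition118KLevelTorus.hT`,
`Σ_□ (h^T_□)² = 1` at every site):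
* §1 **THE COVER READ ON BLOCKS**: `h_□(y) := h^T_□(rep y)` at a representative site `rep y ∈ y` of the torus block `y`
  (`hB`), the enlarged cube `□⁺ := QT □` of p38 (the torus image of `B6Cover236MultiLevelBlocks.Q` of the central cube of
  □'s canonical chart) with its indicator `cubeIndT` and its finer level `jsT □` (`B6Cover236MultiLevelBlocks.js` of the
  central cube); `0 ≤ h_□ ≤ 1`, **`Σ_□ h_□(y)² = 1` on `𝔅_T`** (`sum_hB_sq`), `□⁺·h_□ = h_□` (`cubeIndT_mul_hB`), and the
  **two-level window** `jsT □ ≤ j(y) ≤ jsT □ + 1` on `□⁺` (`hcubeT`, from (2.2) in the chart);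
* §2 **FINITE OVERLAP ON THE TORUS** (`card_filter_hB_ne_zero_le`, `n₀ = 3·2^{d+1}`): in the canonical chart of the block's
  own big block the representative site is `S_k`-deep, every chart cube's box bump there is its transported periodic bump
  (`B6Partition118KLevelTorusChart.thetaF_chart_eq_thetaT`), and the box count `card_filter_thetaF_ne_zero_le` (levels
  `j(y) − 1 … j(y) + 1`, two labels per coordinate — the site twin of `B6Cover236MultiLevelBlocks.card_filter_theta_ne_zero_le`)
  transfers along `cubesEquiv`;
* §3 **THE LIPSCHITZ BOUND IN `d_T`** (`abs_hB_sub_le`): `|h_□(y) − h_□(y″)| ≤ (2s_T/M)·d_T(y, y″)` from p38's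
  `abs_hT_sub_le_distT` (its `+1` absorbed: `d_T ≥ 1` between distinct blocks);
* §4 **THE GAP IN `d_T`** (`gap_hB`, `m_g = 1/(12L²)`): `y ∉ □⁺`, `h_□(y″) ≠ 0 ⟹ (1/(12L²))·M ≤ d_T(y, y″)` — a site-support
  variant of `B6Cover236MultiLevelBlocks.gap_core` in the chart (`gap_core_site`, `m = 1/(12L)`, `M_h ≥ 3`) carried to the
  torus by p38's `B6TorusDepthDistance.gap_transfer` at the threshold `T = M/(2L²)`;
* §5 **`cover236_multiLevelTorusBlocks`** — the seven binders packaged in the exact shape of the box twin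
  `B6Cover236MultiLevelBlocks.cover236_multiLevelBlocks`, for `g = geomT D` (`= geomTB D` on `dist`/`scale`), under
  `L ≥ 2`, `M_h ≥ 3`, `R ≥ 2L`, `P_μ ≥ 5`.

## HONEST SCOPE

READING (ours, as in the box twin): print's `h_□` are functions on the fine lattice ((1.118)); the operator `Q′G′²Q′*` of
Proposition 2.3 acts on `L²(𝔅)` and print writes `h_□(y)`, `y ∈ 𝔅` ((2.83)) — we read `h_□` on a block through ONE
representative site of the block (`rep`, the clamp of the origin into the block; any site would do, the binders' constants
absorb the choice), so that (2.36) on `𝔅_T` is p38's (2.36) on `T_η` verbatim.  The profile is p38's/r01's smooth (1.118)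
profile at the scale `8S/5` (support within `S` of the cube centre), normalised across levels by `(Σθ²)^{−1/2}` (print's
matching of the families across level interfaces is unprinted; divergence recorded by the fold owner, B6-CLOSURE §3.6);
`□⁺` = blocks whose chart-centre is within `5S/4` of the cube centre; print's carrier `T_η` with `Ω₁ = T_η` (p. 224 «we
admit the case when some domains Ω_j are equal to T_η»), lattice units, `P_μ ≥ 5` (the depth of the canonical charts),
`M_h ≥ 3` (the gap), `R ≥ 2L`; constants explicit (`n₀ = 3·2^{d+1}`, `2s_T`, `m_g = 1/(12L²)`), `k`-uniform, not optimised.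
Nothing is inferred from the manuscript: every step is kernel-checked; the quoted sentences locate the statements.
-/

namespace Literature.MathematicalPhysics.QuantumFieldTheory.Balaban1983to89.B6Cover236MultiLevelTorusBlocks

open Finset
open Literature.MathematicalPhysics.QuantumFieldTheory.Balaban1983to89.B4Reflection242 (boxDom mem_boxDom blk)
open Literature.MathematicalPhysics.QuantumFieldTheory.Balaban1983to89.B6MultiLevelBoxOperator (Domains N0 bigSide bigSide_eq
  one_le_bigSide)
open Literature.MathematicalPhysics.QuantumFieldTheory.Balaban1983to89.B6MultiLevelTorusOperator (TDomains tshift)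
open Literature.MathematicalPhysics.QuantumFieldTheory.Balaban1983to89.B6Geom246MultiLevelBox (bset blkOf toR cen bond geom
  dist_toR_cen_le exists_blkOf_eq lev_eq_of_blkOf_eq)
open Literature.MathematicalPhysics.QuantumFieldTheory.Balaban1983to89.B6Geom246MultiLevelTorus (bondT geomT connectedT blkMap
  blkMap_blkOf blkMap_surjective blkMap_injective)
open Literature.MathematicalPhysics.QuantumFieldTheory.Balaban1983to89.B6Cover236MultiLevelBlocks (cubes side side_eq side_pos
  ctr Q mem_Q js hcube window own proj blkOf_proj disp_or_far)
open Literature.MathematicalPhysics.QuantumFieldTheory.Balaban1983to89.B6Eq238MultiLevelTorus (svec)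
open Literature.MathematicalPhysics.QuantumFieldTheory.Balaban1983to89.B6Partition118KLevelFine (hF thetaF dist_lt_of_hF_ne_zero
  dist_lt_of_thetaF_ne_zero blkOf_mem_Q_of_hF_ne_zero lev_window_of_dist_lt)
open Literature.MathematicalPhysics.QuantumFieldTheory.Balaban1983to89.B6TorusDepthDistance (SiteDeep BlkDeep gap_transfer
  blkOf_eq_blkMap_symm)
open Literature.MathematicalPhysics.QuantumFieldTheory.Balaban1983to89.B6Partition118KLevelTorus (thetaT nsqT hT hT_nonneg
  hT_le_one abs_hT_le_one sum_hT_sq thetaT_ne_zero_of_hT_ne_zero thetaT_own_eq_one one_le_sqrt_nsqT)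
open Literature.MathematicalPhysics.QuantumFieldTheory.Balaban1983to89.B6Partition118KLevelTorusChart (cubesEquiv
  cubesEquiv_apply_val thetaF_chart_eq_thetaT abs_sub_ctr_le_of_deep side_le_bigSide_k)
open Literature.MathematicalPhysics.QuantumFieldTheory.Balaban1983to89.B6Partition118KLevelTorusCentral (Dch σch cc side_cc
  hT_eq_hF_cc lev_blkOf_σch QT blkOf_mem_QT_of_hT_ne_zero level_bounds one_le_of_four_le two_le_of_four_le siteDeep_of_dist_le
  blkDeep_of_hF_ne_zero)
open Literature.MathematicalPhysics.QuantumFieldTheory.Balaban1983to89.B6Partition118KLevelTorusBinders (threshold sLipT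
  sLipT_nonneg M_pos abs_hT_sub_le_distT)

noncomputable section

variable {d : ℕ} {ℓ Mh k R : ℕ} {P : Fin (d + 1) → ℕ}

/-! ## §1 The cover read on blocks: `h_□(y) := h^T_□(rep y)`, `□⁺`, the two-level window -/

section Blocks

variable (D : TDomains d ℓ Mh k P R)

/-- **THE REPRESENTATIVE SITE OF A BLOCK** (the clamp of the origin into the block — a site of the block).
[cite: Balaban1984PropagatorsII, (2.45) p.231 («𝔅 the set of all blocks»), dictionary] -/
def rep (D' : Domains d ℓ Mh k P R) (y : ↥(bset D')) : ↥(boxDom (N0 ℓ Mh k P)) := proj D' y 0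

/-- the representative site lies in its block. [cite: Balaban1984PropagatorsII, (2.45) p.231, dictionary] -/
theorem blkOf_rep (D' : Domains d ℓ Mh k P R) (y : ↥(bset D')) : blkOf D' (rep D' y) = y := blkOf_proj D' y 0

/-- **`h_□` ON THE BLOCKS OF THE TORUS**: `h_□(y) := h^T_□(rep y)` (p38's periodic partition of the sites of `T_η`, read at
the representative site of the block). [cite: Balaban1984PropagatorsII, (2.36) p.229, (2.83) p.237 («h²_□(y) … y ∈ 𝔅»)] -/
def hB (c : ↥(cubes D.toDomains)) (y : ↥(bset D.toDomains)) : ℝ := hT D c (rep D.toDomains y)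

/-- **THE INDICATOR OF THE ENLARGED CUBE `□⁺`** (p38's torus block set `QT □` = the image of `B6Cover236MultiLevelBlocks.Q`
of the central cube of □'s canonical chart; the binder `pf`). [cite: Balaban1984PropagatorsII, (2.82) p.237 («(□′ − 1)»), p.235] -/
def cubeIndT (hMh1 : 1 ≤ Mh) (hP4 : ∀ μ, 4 ≤ P μ) (c : ↥(cubes D.toDomains)) (y : ↥(bset D.toDomains)) : ℝ :=
  if y ∈ QT D hMh1 hP4 c then 1 else 0

/-- **THE SCALE `j(□)` OF THE TORUS CUBE** («□ connected with a L^jη-scale»): the finer of the (at most two) levels met by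
`□⁺`, read in the canonical chart (`B6Cover236MultiLevelBlocks.js` of the central cube). [cite: Balaban1984PropagatorsII, p.235, p.237 (2.83)] -/
def jsT (hMh1 : 1 ≤ Mh) (hP4 : ∀ μ, 4 ≤ P μ) (c : ↥(cubes D.toDomains)) : ℕ := js (Dch D c) (cc D hMh1 hP4 c)

/-- `h_□ ≥ 0`. [cite: Balaban1984PropagatorsII, (2.36) p.229, bookkeeping] -/
theorem hB_nonneg (c : ↥(cubes D.toDomains)) (y : ↥(bset D.toDomains)) : 0 ≤ hB D c y := hT_nonneg D c _

/-- `h_□ ≤ 1`. [cite: Balaban1984PropagatorsII, (2.36) p.229, bookkeeping] -/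
theorem hB_le_one (hMh : 1 ≤ Mh) (hP : ∀ μ, 1 ≤ P μ) (c : ↥(cubes D.toDomains)) (y : ↥(bset D.toDomains)) :
    hB D c y ≤ 1 := hT_le_one D hMh hP c _

/-- `|h_□| ≤ 1`. [cite: Balaban1984PropagatorsII, (2.36) p.229, bookkeeping] -/
theorem abs_hB_le_one (hMh : 1 ≤ Mh) (hP : ∀ μ, 1 ≤ P μ) (c : ↥(cubes D.toDomains)) (y : ↥(bset D.toDomains)) :
    |hB D c y| ≤ 1 := abs_hT_le_one D hMh hP c _

/-- **(2.36) ON THE BLOCK LATTICE OF THE TORUS: `Σ_{□∈𝒟} h_□(y)² = 1` FOR EVERY `y ∈ 𝔅_T`** (the binder `h236`).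
[cite: Balaban1984PropagatorsII, (2.36) p.229 («They satisfy Σ_{□∈𝒟} h_□² = 1»)] -/
theorem sum_hB_sq (hMh : 1 ≤ Mh) (hP : ∀ μ, 1 ≤ P μ) (y : ↥(bset D.toDomains)) : ∑ c, hB D c y ^ 2 = 1 :=
  sum_hT_sq D hMh hP _

/-- `cubeIndT ∈ {0, 1}` (the binder `hpf01`). [cite: Balaban1984PropagatorsII, (2.82) p.237 («(□′ − 1)»), bookkeeping] -/
theorem cubeIndT_zero_or_one (hMh1 : 1 ≤ Mh) (hP4 : ∀ μ, 4 ≤ P μ) (c : ↥(cubes D.toDomains)) (y : ↥(bset D.toDomains)) :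
    cubeIndT D hMh1 hP4 c y = 0 ∨ cubeIndT D hMh1 hP4 c y = 1 := by
  unfold cubeIndT; split_ifs <;> simp

/-- `cubeIndT = 0 ⟺ ∉ □⁺`. [cite: Balaban1984PropagatorsII, (2.82) p.237, bookkeeping] -/
theorem cubeIndT_eq_zero_iff (hMh1 : 1 ≤ Mh) (hP4 : ∀ μ, 4 ≤ P μ) {c : ↥(cubes D.toDomains)} {y : ↥(bset D.toDomains)} :
    cubeIndT D hMh1 hP4 c y = 0 ↔ y ∉ QT D hMh1 hP4 c := by
  unfold cubeIndT; split_ifs with h <;> simp [h]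

/-- `h_□(y) ≠ 0 ⟹ y ∈ □⁺` (p38's `blkOf_mem_QT_of_hT_ne_zero` at the representative site). [cite: Balaban1984PropagatorsII, p.235, bookkeeping] -/
theorem mem_QT_of_hB_ne_zero (hMh : 2 ≤ Mh) (hR : 2 * (ℓ + 1) ≤ R) (hMh1 : 1 ≤ Mh) (hP4 : ∀ μ, 4 ≤ P μ)
    {c : ↥(cubes D.toDomains)} {y : ↥(bset D.toDomains)} (h : hB D c y ≠ 0) : y ∈ QT D hMh1 hP4 c := by
  have hmem := blkOf_mem_QT_of_hT_ne_zero (D := D) hMh hR (hMh1 := hMh1) hP4 c (z := rep D.toDomains y) h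
  rwa [blkOf_rep] at hmem

/-- **`□⁺·h_□ = h_□`** (the binder `hph`). [cite: Balaban1984PropagatorsII, (2.82) p.237] -/
theorem cubeIndT_mul_hB (hMh : 2 ≤ Mh) (hR : 2 * (ℓ + 1) ≤ R) (hMh1 : 1 ≤ Mh) (hP4 : ∀ μ, 4 ≤ P μ)
    (c : ↥(cubes D.toDomains)) (y : ↥(bset D.toDomains)) : cubeIndT D hMh1 hP4 c y * hB D c y = hB D c y := by
  by_cases h : hB D c y = 0
  · rw [h, mul_zero]
  · unfold cubeIndT; rw [if_pos (mem_QT_of_hB_ne_zero D hMh hR hMh1 hP4 h), one_mul]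

/-- the block map of a chart preserves levels. [cite: Balaban1984PropagatorsII, (2.3)–(2.4) p.224, dictionary (charts)] -/
theorem blkMap_fst (hMh : 1 ≤ Mh) (hP : ∀ μ, 1 ≤ P μ) (c : ↥(cubes D.toDomains)) (b : ↥(bset (Dch D c))) :
    (blkMap D (svec ℓ k c.1.1 c.1.2) b).1.1 = b.1.1 := by
  obtain ⟨x, rfl⟩ := exists_blkOf_eq (Dch D c) b
  have h := blkMap_blkOf (D := D) hMh hP (svec ℓ k c.1.1 c.1.2) x
  rw [h]
  exact lev_blkOf_σch c x

/-- **THE TWO-LEVEL WINDOW OF `□⁺` ON THE TORUS** (the binder `hcube`): every block of `□⁺` has level `jsT □` or `jsT □ + 1`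
(`B6Cover236MultiLevelBlocks.hcube` in the canonical chart — (2.2) with `R ≥ 2L`, never both `j − 1` and `j + 1`).
[cite: Balaban1984PropagatorsII, p.235 («either □̃ ⊂ B^j(Λ_j), or it intersects B^{j+1}(Λ_{j+1}) also»), (2.2) p.224] -/
theorem hcubeT (hℓ : 1 ≤ ℓ) (hMh1 : 1 ≤ Mh) (hR : 2 * (ℓ + 1) ≤ R) (hP4 : ∀ μ, 4 ≤ P μ) {c : ↥(cubes D.toDomains)}
    {y : ↥(bset D.toDomains)} (hy : y ∈ QT D hMh1 hP4 c) : jsT D hMh1 hP4 c ≤ y.1.1 ∧ y.1.1 ≤ jsT D hMh1 hP4 c + 1 := by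
  unfold QT at hy
  obtain ⟨b, hb, rfl⟩ := Finset.mem_image.1 hy
  rw [blkMap_fst D hMh1 (one_le_of_four_le hP4) c b]
  exact hcube (Dch D c) hℓ hMh1 hR hb

end Blocks

/-! ## §2 Finite overlap on the torus -/

section Overlap

/-- the label of a cube active near a point is one of two per coordinate (site twin of
`B6Cover236MultiLevelBlocks.near_coord`). [cite: Balaban1984PropagatorsII, p.229 («each cube being a sum of 2^d big blocks»), bookkeeping] -/
theorem near_coord_pt (D' : Domains d ℓ Mh k P R) (hMh : 1 ≤ Mh) {i : ↥(cubes D')} {p : Fin (d + 1) → ℝ}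
    (h : dist p (ctr D' i) < side D' i) (μ : Fin (d + 1)) :
    i.1.2 μ - ⌊p μ / side D' i - 1 / 2⌋ ∈ ({0, 1} : Finset ℤ) := by
  have hS := side_pos D' hMh i
  have hμ := lt_of_le_of_lt (dist_le_pi_dist p (ctr D' i) μ) h
  rw [Real.dist_eq] at hμ
  obtain ⟨u, hu⟩ : ∃ u : ℝ, u = p μ / side D' i - 1 / 2 := ⟨_, rfl⟩
  have hβ : |u - (i.1.2 μ : ℝ)| < 1 := by
    have e : u - (i.1.2 μ : ℝ) = (p μ - ctr D' i μ) / side D' i := by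
      rw [hu]; unfold ctr; field_simp; ring
    rw [e, abs_div, abs_of_pos hS, div_lt_one hS]; exact hμ
  have h1 := Int.floor_le u
  have h2 := Int.lt_floor_add_one u
  rw [abs_lt] at hβ
  have hge : ⌊u⌋ ≤ i.1.2 μ := by
    by_contra hlt
    have : (i.1.2 μ : ℝ) + 1 ≤ (⌊u⌋ : ℝ) := by exact_mod_cast (show i.1.2 μ + 1 ≤ ⌊u⌋ by omega)
    linarith
  have hle : i.1.2 μ ≤ ⌊u⌋ + 1 := by
    by_contra hlt
    have : (⌊u⌋ : ℝ) + 2 ≤ (i.1.2 μ : ℝ) := by exact_mod_cast (show ⌊u⌋ + 2 ≤ i.1.2 μ by omega)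
    linarith
  rw [← hu, Finset.mem_insert, Finset.mem_singleton]; omega

/-- **FINITE OVERLAP OF THE FINE BUMPS AT A SITE** (box family): at most `3·2^{d+1}` of the (1.118)-bumps `θ_□` are non-zero
at a fine site (levels `j(x) − 1 … j(x) + 1` by the two-level window, two labels per coordinate) — the site twin of
`B6Cover236MultiLevelBlocks.card_filter_theta_ne_zero_le`. [cite: Balaban1984PropagatorsII, p.229 («each cube being a sum of 2^d big blocks»), (2.2) p.224] -/
theorem card_filter_thetaF_ne_zero_le (D' : Domains d ℓ Mh k P R) (hMh : 1 ≤ Mh) (hR : 2 * (ℓ + 1) ≤ R)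
    (x : ↥(boxDom (N0 ℓ Mh k P))) :
    #(Finset.univ.filter fun i : ↥(cubes D') => thetaF D' i (toR x.1) ≠ 0) ≤ 3 * 2 ^ (d + 1) := by
  classical
  obtain ⟨m, hm⟩ : ∃ m : ℕ → Fin (d + 1) → ℤ, m = fun j μ => ⌊toR x.1 μ / (bigSide ℓ Mh j : ℝ) - 1 / 2⌋ := ⟨_, rfl⟩
  obtain ⟨T, hT⟩ : ∃ T : Finset (ℕ × (Fin (d + 1) → ℤ)), T = (Finset.Icc (D'.lev x.1 - 1) (D'.lev x.1 + 1)).biUnion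
    fun j => (Fintype.piFinset fun _ : Fin (d + 1) => ({0, 1} : Finset ℤ)).image fun e => (j, fun μ => m j μ + e μ) :=
    ⟨_, rfl⟩
  have hT3 : #T ≤ 3 * 2 ^ (d + 1) := by
    rw [hT]
    refine Finset.card_biUnion_le.trans ?_
    calc ∑ j ∈ Finset.Icc (D'.lev x.1 - 1) (D'.lev x.1 + 1),
          #((Fintype.piFinset fun _ : Fin (d + 1) => ({0, 1} : Finset ℤ)).image fun e => (j, fun μ => m j μ + e μ))
        ≤ ∑ _j ∈ Finset.Icc (D'.lev x.1 - 1) (D'.lev x.1 + 1), 2 ^ (d + 1) := Finset.sum_le_sum fun j _ => by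
          refine Finset.card_image_le.trans (le_of_eq ?_)
          rw [Fintype.card_piFinset_const, Finset.card_pair (by norm_num)]
      _ = #(Finset.Icc (D'.lev x.1 - 1) (D'.lev x.1 + 1)) * 2 ^ (d + 1) := by rw [Finset.sum_const, smul_eq_mul]
      _ ≤ 3 * 2 ^ (d + 1) := by rw [Nat.card_Icc]; exact Nat.mul_le_mul_right _ (by omega)
  have hsub : (Finset.univ.filter fun i : ↥(cubes D') => thetaF D' i (toR x.1) ≠ 0).map
      ⟨Subtype.val, Subtype.val_injective⟩ ⊆ T := by
    intro c hc
    rw [Finset.mem_map] at hc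
    obtain ⟨i, hi, rfl⟩ := hc
    have hne := (Finset.mem_filter.1 hi).2
    have hdist := dist_lt_of_thetaF_ne_zero D' hMh hne
    have hw := lev_window_of_dist_lt D' hMh hR hdist
    rw [hT, Finset.mem_biUnion]
    refine ⟨i.1.1, by rw [Finset.mem_Icc]; omega, ?_⟩
    rw [Finset.mem_image]
    refine ⟨fun μ => i.1.2 μ - m i.1.1 μ, ?_, ?_⟩
    · rw [Fintype.mem_piFinset]; intro μ; rw [hm]; exact near_coord_pt D' hMh hdist μ
    · show (i.1.1, fun μ => m i.1.1 μ + (i.1.2 μ - m i.1.1 μ)) = i.1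
      refine Prod.ext rfl (funext fun μ => ?_)
      show m i.1.1 μ + (i.1.2 μ - m i.1.1 μ) = i.1.2 μ
      ring
  calc #(Finset.univ.filter fun i : ↥(cubes D') => thetaF D' i (toR x.1) ≠ 0)
      = #((Finset.univ.filter fun i : ↥(cubes D') => thetaF D' i (toR x.1) ≠ 0).map
          ⟨Subtype.val, Subtype.val_injective⟩) := (Finset.card_map _).symm
    _ ≤ #T := Finset.card_le_card hsub
    _ ≤ 3 * 2 ^ (d + 1) := hT3

variable (D : TDomains d ℓ Mh k P R)

/-- **THE REPRESENTATIVE SITE IS `S_k`-DEEP IN THE CANONICAL CHART OF THE BLOCK'S OWN BIG BLOCK** (`P_μ ≥ 5`): its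
pre-image lies in the support of the central cube's bump (the own big block's periodic bump is `1` at every site of the
block), hence within `S` of the central cube's centre. [cite: Balaban1984PropagatorsII, (2.36) p.229, dictionary (charts)] -/
theorem siteDeep_rep (hMh : 1 ≤ Mh) (hP5 : ∀ μ, 5 ≤ P μ) (hP4 : ∀ μ, 4 ≤ P μ) (y : ↥(bset D.toDomains)) :
    SiteDeep (N0 ℓ Mh k P) (bigSide ℓ Mh k : ℤ)
      ((σch D (own D.toDomains y)).symm (rep D.toDomains y)).1 := by
  have hP : ∀ μ, 1 ≤ P μ := one_le_of_four_le hP4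
  obtain ⟨c₀, hc₀⟩ : ∃ c₀ : ↥(cubes D.toDomains), c₀ = own D.toDomains y := ⟨_, rfl⟩
  obtain ⟨z, hz⟩ : ∃ z : ↥(boxDom (N0 ℓ Mh k P)), z = rep D.toDomains y := ⟨_, rfl⟩
  -- the own big block's periodic bump is `1` at the representative site, so `h^T_{c₀}(z) ≠ 0`
  have hθ : thetaT ℓ Mh (N0 ℓ Mh k P) c₀.1 z.1 = 1 := by
    have h := thetaT_own_eq_one D hMh hP z
    rwa [hz, blkOf_rep, ← hz, ← hc₀] at h
  have hT0 : hT D c₀ z ≠ 0 := by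
    unfold hT
    rw [hθ]
    exact div_ne_zero one_ne_zero (ne_of_gt (lt_of_lt_of_le one_pos (one_le_sqrt_nsqT D hMh hP z)))
  -- read in the canonical chart of `c₀`: the central cube's box function is non-zero at `σ⁻¹ z`
  rw [hT_eq_hF_cc hMh hP4 c₀ z] at hT0
  have hdist := dist_lt_of_hF_ne_zero (Dch D c₀) hMh hT0
  rw [side_cc] at hdist
  rw [← hc₀, ← hz]
  refine siteDeep_of_dist_le (hP4 := hP4) hMh hP5 c₀ ?_
  have : (0 : ℝ) ≤ (bigSide ℓ Mh c₀.1.1 : ℝ) := by positivity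
  linarith

/-- **FINITE OVERLAP OF THE COVER OF `𝔅_T`** (the binder `hover`, `n₀ = 3·2^{d+1}`): at most `3·2^{d+1}` of the `h_□` are
non-zero at a torus block. [cite: Balaban1984PropagatorsII, p.229 («each cube being a sum of 2^d big blocks»), (2.36) p.229] -/
theorem card_filter_hB_ne_zero_le (hMh : 1 ≤ Mh) (hR : 2 * (ℓ + 1) ≤ R) (hP5 : ∀ μ, 5 ≤ P μ) (y : ↥(bset D.toDomains)) :
    #(Finset.univ.filter fun c : ↥(cubes D.toDomains) => hB D c y ≠ 0) ≤ 3 * 2 ^ (d + 1) := by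
  classical
  have hP4 : ∀ μ, 4 ≤ P μ := fun μ => le_trans (by norm_num) (hP5 μ)
  have hP2 : ∀ μ, 2 ≤ P μ := two_le_of_four_le hP4
  have hP : ∀ μ, 1 ≤ P μ := one_le_of_four_le hP4
  obtain ⟨c₀, hc₀⟩ : ∃ c₀ : ↥(cubes D.toDomains), c₀ = own D.toDomains y := ⟨_, rfl⟩
  obtain ⟨z, hz⟩ : ∃ z : ↥(boxDom (N0 ℓ Mh k P)), z = rep D.toDomains y := ⟨_, rfl⟩
  obtain ⟨s, hs⟩ : ∃ s : Fin (d + 1) → ℤ, s = svec ℓ k c₀.1.1 c₀.1.2 := ⟨_, rfl⟩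
  obtain ⟨w, hw⟩ : ∃ w : ↥(boxDom (N0 ℓ Mh k P)), w = (σch D c₀).symm z := ⟨_, rfl⟩
  have hdeep : SiteDeep (N0 ℓ Mh k P) (bigSide ℓ Mh k : ℤ) w.1 := by
    rw [hw, hz, hc₀]; exact siteDeep_rep D hMh hP5 hP4 y
  have hσw : (tshift (N0 ℓ Mh k P) (TDomains.tvec ℓ Mh k s) w) = z := by
    rw [hw, hs]; exact (σch D c₀).apply_symm_apply z
  -- every chart cube's box bump at `w` is the periodic bump of the transported cube at `z`
  have hθ : ∀ i : ↥(cubes (D.chart s).toDomains),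
      thetaF (D.chart s).toDomains i (toR w.1) = thetaT ℓ Mh (N0 ℓ Mh k P) (cubesEquiv D hMh hP s i).1 z.1 := by
    intro i
    rw [cubesEquiv_apply_val, ← hσw]
    refine thetaF_chart_eq_thetaT (D := D) hMh hP2 s i w fun μ => abs_sub_ctr_le_of_deep hMh _ i w (fun ν => ?_) μ
    have hSi := side_le_bigSide_k (D.chart s).toDomains i
    obtain ⟨h1, h2⟩ := hdeep ν
    have h1r : ((bigSide ℓ Mh k : ℕ) : ℝ) ≤ (w.1 ν : ℝ) := by exact_mod_cast h1
    have h2r : (w.1 ν : ℝ) + (bigSide ℓ Mh k : ℕ) ≤ (N0 ℓ Mh k P ν : ℝ) := by exact_mod_cast h2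
    have hS0 : 0 ≤ side (D.chart s).toDomains i := (side_pos _ hMh i).le
    constructor <;> linarith
  -- the non-zero `h_□` at `y` inject into the non-zero box bumps at `w`
  have hsub : (Finset.univ.filter fun c : ↥(cubes D.toDomains) => hB D c y ≠ 0).image (cubesEquiv D hMh hP s).symm ⊆
      Finset.univ.filter fun i : ↥(cubes (D.chart s).toDomains) => thetaF (D.chart s).toDomains i (toR w.1) ≠ 0 := by
    intro i hi
    rw [Finset.mem_image] at hi
    obtain ⟨c, hc, rfl⟩ := hi
    have hne := (Finset.mem_filter.1 hc).2
    rw [Finset.mem_filter]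
    refine ⟨Finset.mem_univ _, ?_⟩
    rw [hθ, Equiv.apply_symm_apply]
    have h' : hT D c z ≠ 0 := by rw [hz]; exact hne
    exact thetaT_ne_zero_of_hT_ne_zero D h'
  calc #(Finset.univ.filter fun c : ↥(cubes D.toDomains) => hB D c y ≠ 0)
      = #((Finset.univ.filter fun c : ↥(cubes D.toDomains) => hB D c y ≠ 0).image (cubesEquiv D hMh hP s).symm) :=
        (Finset.card_image_of_injective _ (cubesEquiv D hMh hP s).symm.injective).symm
    _ ≤ #(Finset.univ.filter fun i : ↥(cubes (D.chart s).toDomains) => thetaF (D.chart s).toDomains i (toR w.1) ≠ 0) :=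
        Finset.card_le_card hsub
    _ ≤ 3 * 2 ^ (d + 1) := card_filter_thetaF_ne_zero_le _ hMh hR w

end Overlap

/-! ## §3 The Lipschitz bound of `h_□` in the distance (2.46) of the torus -/

section Lipschitz

variable (D : TDomains d ℓ Mh k P R)

/-- **THE LIPSCHITZ BOUND OF `h_□` IN `d_T`** (the binder `hLip`, `s = 2s_T`): `|h_□(y) − h_□(y″)| ≤ (2s_T/M)·d_T(y, y″)`,
`M = L·M_h` — p38's `|h^T_□(z′) − h^T_□(z)| ≤ (s_T/M)(d_T + 1)` at the representative sites, the `+1` absorbed by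
`d_T(y, y″) ≥ 1` for `y ≠ y″` («an estimate of the terms with the commutator … gives a factor O(M⁻¹)»).
[cite: Balaban1984PropagatorsII, p.238 («gives a factor O(M⁻¹)»), (2.83)–(2.84) p.237, (2.46) p.231] -/
theorem abs_hB_sub_le (hℓ : 1 ≤ ℓ) (hMh : 2 ≤ Mh) (hR : 2 * (ℓ + 1) ≤ R) (hP5 : ∀ μ, 5 ≤ P μ)
    (c : ↥(cubes D.toDomains)) (y y'' : ↥(bset D.toDomains)) :
    |hB D c y - hB D c y''| ≤ 2 * sLipT d ℓ / (((ℓ : ℝ) + 1) * Mh) * (geomT D).dist y y'' := by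
  have hMh1 : 1 ≤ Mh := le_trans (by norm_num) hMh
  have hP : ∀ μ, 1 ≤ P μ := fun μ => le_trans (by norm_num) (hP5 μ)
  have hM := M_pos (ℓ := ℓ) hMh1
  have hs := sLipT_nonneg d ℓ
  by_cases hyy : y = y''
  · subst hyy
    rw [sub_self, abs_zero]
    have : 0 ≤ (geomT D).dist y y := by show (0 : ℝ) ≤ ((bondT D).dist y y : ℝ); positivity
    positivity
  have h := abs_hT_sub_le_distT (D := D) hℓ hMh hR hP5 c (rep D.toDomains y'') (rep D.toDomains y)
  rw [blkOf_rep, blkOf_rep, SimpleGraph.dist_comm] at h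
  have hd1 : (1 : ℝ) ≤ ((bondT D).dist y y'' : ℝ) := by
    have hpos := (connectedT (D := D) hMh1 hP).pos_dist_of_ne hyy
    exact_mod_cast hpos
  show |hT D c (rep D.toDomains y) - hT D c (rep D.toDomains y'')| ≤
    2 * sLipT d ℓ / (((ℓ : ℝ) + 1) * Mh) * ((bondT D).dist y y'' : ℝ)
  calc |hT D c (rep D.toDomains y) - hT D c (rep D.toDomains y'')|
      ≤ sLipT d ℓ / (((ℓ : ℝ) + 1) * Mh) * (((bondT D).dist y y'' : ℝ) + 1) := h
    _ ≤ sLipT d ℓ / (((ℓ : ℝ) + 1) * Mh) * (2 * ((bondT D).dist y y'' : ℝ)) :=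
        mul_le_mul_of_nonneg_left (by linarith) (div_nonneg hs hM.le)
    _ = 2 * sLipT d ℓ / (((ℓ : ℝ) + 1) * Mh) * ((bondT D).dist y y'' : ℝ) := by ring

end Lipschitz

/-! ## §4 The gap between the outside of `□⁺` and `supp h_□` in the distance (2.46) of the torus -/

section Gap

/-- **THE CORE OF THE GAP, SITE FORM** (box family, `M_h ≥ 3`): if `b ∉ □⁺` and `h_□(x) ≠ 0` at a fine site `x`, then
`(1/(12L))·M ≤ d(b, block of x)` — the block of `x` lies in `□⁺` within `S + S/(2M_h)` of the centre, `b` farther than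
`5S/4`, so the shortest chain covers the sup-gap `S/12` at `≤ L^{j+1} = S/M_h` per bond, or exits to `B^{j+2}`
(`B6Cover236MultiLevelBlocks.disp_or_far`). [cite: Balaban1984PropagatorsII, (2.83) p.237 («where we have used the fact that y ∉ □̃′»), (2.46) p.231] -/
theorem gap_core_site (D' : Domains d ℓ Mh k P R) (hMh : 3 ≤ Mh) (hP : ∀ μ, 1 ≤ P μ) (hR : 2 * (ℓ + 1) ≤ R)
    {i : ↥(cubes D')} {b : ↥(bset D')} {x : ↥(boxDom (N0 ℓ Mh k P))} (hb : b ∉ Q D' i) (hx : hF D' i x ≠ 0) :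
    1 / (12 * ((ℓ : ℝ) + 1)) * (((ℓ : ℝ) + 1) * Mh) ≤ (geom D').dist b (blkOf D' x) := by
  have hMh1 : 1 ≤ Mh := le_trans (by norm_num) hMh
  have hMh2 : 2 ≤ Mh := le_trans (by norm_num) hMh
  have hMh3 : (3 : ℝ) ≤ Mh := by exact_mod_cast hMh
  have hL1 : (1 : ℝ) ≤ (ℓ : ℝ) + 1 := by linarith [(Nat.cast_nonneg ℓ : (0 : ℝ) ≤ ℓ)]
  have hS := side_pos D' hMh1 i
  have eS : side D' i = (((ℓ + 1) ^ (i.1.1 + 1) : ℕ) : ℝ) * Mh := side_eq D' i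
  have hLp : (0 : ℝ) < (((ℓ + 1) ^ (i.1.1 + 1) : ℕ) : ℝ) := by positivity
  obtain ⟨b'', hb''⟩ : ∃ b'' : ↥(bset D'), b'' = blkOf D' x := ⟨_, rfl⟩
  have hxd : dist (toR x.1) (ctr D' i) < side D' i := dist_lt_of_hF_ne_zero D' hMh1 hx
  have hQ : b'' ∈ Q D' i := by rw [hb'']; exact blkOf_mem_Q_of_hF_ne_zero D' hMh2 hR hx
  have hlev : b''.1.1 ≤ i.1.1 + 1 := (window D' hMh1 hR hQ).2
  have hcen : dist (toR x.1) (cen D' b'') ≤ ((((ℓ + 1) ^ b''.1.1 : ℕ) : ℝ) - 1) / 2 := dist_toR_cen_le D' hb''.symm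
  have hpow : (((ℓ + 1) ^ b''.1.1 : ℕ) : ℝ) ≤ (((ℓ + 1) ^ (i.1.1 + 1) : ℕ) : ℝ) := by
    exact_mod_cast Nat.pow_le_pow_right (by omega) hlev
  -- the block of `x` is within `S + S/(2M_h)` of the centre, `b` farther than `5S/4`: sup-gap `> S/12`
  have hnear : dist (cen D' b'') (ctr D' i) ≤ side D' i + side D' i / (2 * Mh) := by
    have htri := dist_triangle (cen D' b'') (toR x.1) (ctr D' i)
    rw [dist_comm (cen D' b'') (toR x.1)] at htri
    have h1 : (((ℓ + 1) ^ (i.1.1 + 1) : ℕ) : ℝ) = side D' i / Mh := by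
      rw [eS]; field_simp
    have h2 : ((((ℓ + 1) ^ b''.1.1 : ℕ) : ℝ) - 1) / 2 ≤ side D' i / (2 * Mh) := by
      rw [h1] at hpow
      have : side D' i / (2 * Mh) = (side D' i / Mh) / 2 := by field_simp
      rw [this]; linarith
    linarith
  have hbfar : 5 / 4 * side D' i < dist (cen D' b) (ctr D' i) := by
    rw [mem_Q] at hb; push Not at hb; exact hb
  have hfar : side D' i / 12 < dist (cen D' b'') (cen D' b) := by
    have htri := dist_triangle (cen D' b) (cen D' b'') (ctr D' i)
    rw [dist_comm (cen D' b) (cen D' b'')] at htri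
    have h6 : side D' i / (2 * Mh) ≤ side D' i / 6 := by
      rw [div_le_div_iff₀ (by positivity) (by norm_num)]; nlinarith
    linarith
  -- the chain from `b″ ∈ □⁺` to `b`: either it covers the sup-gap at `≤ L^{j+1}` per bond, or it exits to `B^{j+2}`
  have key : (Mh : ℝ) / 12 < ((bond D').dist b'' b : ℝ) := by
    rcases disp_or_far D' hMh1 hP hR hQ (y := b) with h | h
    · -- `S/12 < d·L^{j+1}` with `S = L^{j+1}·M_h`
      have h1 : side D' i / 12 < ((bond D').dist b'' b : ℝ) * (((ℓ + 1) ^ (i.1.1 + 1) : ℕ) : ℝ) := lt_of_lt_of_le hfar h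
      rw [eS] at h1
      by_contra hle
      push Not at hle
      have := mul_le_mul_of_nonneg_right hle hLp.le
      nlinarith
    · -- the exit costs `(RL − 7/4)S ≥ S/4`
      have hR1 : (2 : ℝ) * ((ℓ : ℝ) + 1) ≤ R := by exact_mod_cast hR
      have hR2 : (2 : ℝ) ≤ R := by linarith
      have hRL : (2 : ℝ) ≤ (R : ℝ) * ((ℓ : ℝ) + 1) := by nlinarith
      rw [eS] at h
      by_contra hle
      push Not at hle
      have h1 := mul_le_mul_of_nonneg_right hle hLp.le
      have hSM : (0 : ℝ) < (((ℓ + 1) ^ (i.1.1 + 1) : ℕ) : ℝ) * Mh := by positivity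
      have h2 : (1 / 4 : ℝ) * ((((ℓ + 1) ^ (i.1.1 + 1) : ℕ) : ℝ) * Mh) ≤
          ((R : ℝ) * ((ℓ : ℝ) + 1) - 7 / 4) * ((((ℓ + 1) ^ (i.1.1 + 1) : ℕ) : ℝ) * Mh) :=
        mul_le_mul_of_nonneg_right (by linarith) hSM.le
      nlinarith
  have e : (geom D').dist b (blkOf D' x) = ((bond D').dist b'' b : ℝ) := by
    rw [← hb'']
    show (((bond D').dist b b'' : ℕ) : ℝ) = _
    rw [SimpleGraph.dist_comm]
  rw [e]
  have hL0 : (0 : ℝ) < (ℓ : ℝ) + 1 := by positivity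
  have e2 : 1 / (12 * ((ℓ : ℝ) + 1)) * (((ℓ : ℝ) + 1) * Mh) = (Mh : ℝ) / 12 := by field_simp
  rw [e2]
  exact key.le

variable (D : TDomains d ℓ Mh k P R)

/-- **THE GAP ON THE TORUS** (the binder `hgap`, `m_g = 1/(12L²)`): if `y ∉ □⁺` and `h_□(y″) ≠ 0` then
`(1/(12L²))·M ≤ d_T(y, y″)`, `M = L·M_h` — the box gap of the canonical chart (`gap_core_site`, `m = 1/(12L)`) carried to
the torus by p38's `gap_transfer` at the threshold `T = M/(2L²)` («y ∉ □̃′ … all the properties of the distance d(·,·)»).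
[cite: Balaban1984PropagatorsII, (2.83) p.237 («where we have used the fact that y ∉ □̃′»), (2.46) p.231] -/
theorem gap_hB (hℓ : 1 ≤ ℓ) (hMh : 3 ≤ Mh) (hR : 2 * (ℓ + 1) ≤ R) (hP5 : ∀ μ, 5 ≤ P μ) (hMh1 : 1 ≤ Mh)
    (hP4 : ∀ μ, 4 ≤ P μ) (c : ↥(cubes D.toDomains)) {y y'' : ↥(bset D.toDomains)} (hy : y ∉ QT D hMh1 hP4 c)
    (hy'' : hB D c y'' ≠ 0) : 1 / (12 * ((ℓ : ℝ) + 1) ^ 2) * (((ℓ : ℝ) + 1) * Mh) ≤ (geomT D).dist y y'' := by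
  classical
  have hMh2 : 2 ≤ Mh := le_trans (by norm_num) hMh
  have hP : ∀ μ, 1 ≤ P μ := one_le_of_four_le hP4
  obtain ⟨hj, hjk⟩ := level_bounds D.toDomains c
  obtain ⟨hT0, hTw, hTR⟩ := threshold (k := k) hℓ hMh1 hR hj hjk
  -- pull the two torus blocks back to chart blocks
  obtain ⟨b, hbe⟩ := blkMap_surjective (D := D) hMh1 hP (svec ℓ k c.1.1 c.1.2) y
  have hb : b ∉ Q (Dch D c) (cc D hMh1 hP4 c) := by
    intro hmem
    apply hy
    unfold QT
    rw [← hbe]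
    exact Finset.mem_image_of_mem _ hmem
  obtain ⟨x, hx⟩ : ∃ x : ↥(boxDom (N0 ℓ Mh k P)), x = (σch D c).symm (rep D.toDomains y'') := ⟨_, rfl⟩
  have hxF : hF (Dch D c) (cc D hMh1 hP4 c) x ≠ 0 := by
    have h := hy''
    unfold hB at h
    rwa [hT_eq_hF_cc hMh1 hP4 c, ← hx] at h
  have hy''e : blkMap D (svec ℓ k c.1.1 c.1.2) (blkOf (Dch D c) x) = y'' := by
    have h := blkOf_eq_blkMap_symm (D := D) hMh1 hP (svec ℓ k c.1.1 c.1.2) (rep D.toDomains y'')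
    rw [blkOf_rep] at h
    rw [hx]; exact h.symm
  -- the box gap of the chart, transferred
  have key := gap_transfer (D := D) hMh1 hP (svec ℓ k c.1.1 c.1.2)
    (S := {a | ∃ x' : ↥(boxDom (N0 ℓ Mh k P)), blkOf (Dch D c) x' = a ∧ hF (Dch D c) (cc D hMh1 hP4 c) x' ≠ 0})
    (Score := ↑(Q (Dch D c) (cc D hMh1 hP4 c))) (w := ((bigSide ℓ Mh k : ℕ) : ℤ)) (j := c.1.1)
    (m := 1 / (12 * ((ℓ : ℝ) + 1))) (M := ((ℓ : ℝ) + 1) * Mh) (T := (Mh : ℝ) / (2 * ((ℓ : ℝ) + 1)))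
    (M_pos hMh1) hT0 (fun a ⟨x', hx'a, hx'⟩ => hx'a ▸ blkDeep_of_hF_ne_zero hMh2 hR hP5 c hx') hTw hTR
    (fun y₁ y₂ h₁ ⟨x', hx'a, hx'⟩ => by
      rw [← hx'a]
      exact gap_core_site (Dch D c) hMh hP hR (fun hm => h₁ (Finset.mem_coe.2 hm)) hx')
    b (blkOf (Dch D c) x) (fun hm => hb (Finset.mem_coe.1 hm)) ⟨x, rfl, hxF⟩
  rw [hbe, hy''e] at key
  -- `1/(12L²) ≤ min(1/(12L), T/M)` with `T/M = 1/(2L²)`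
  have hL1 : (1 : ℝ) ≤ (ℓ : ℝ) + 1 := by linarith [(Nat.cast_nonneg ℓ : (0 : ℝ) ≤ ℓ)]
  have hL0 : (0 : ℝ) < (ℓ : ℝ) + 1 := by positivity
  have hMpos := M_pos (ℓ := ℓ) hMh1
  have hM0 : (0 : ℝ) < Mh := by
    have h1 : (1 : ℝ) ≤ Mh := by exact_mod_cast hMh1
    linarith
  have hmin : 1 / (12 * ((ℓ : ℝ) + 1) ^ 2) ≤
      min (1 / (12 * ((ℓ : ℝ) + 1))) ((Mh : ℝ) / (2 * ((ℓ : ℝ) + 1)) / (((ℓ : ℝ) + 1) * Mh)) := by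
    refine le_min ?_ ?_
    · rw [div_le_div_iff₀ (by positivity) (by positivity)]; nlinarith
    · rw [div_div, div_le_div_iff₀ (by positivity) (by positivity)]; nlinarith
  show 1 / (12 * ((ℓ : ℝ) + 1) ^ 2) * (((ℓ : ℝ) + 1) * Mh) ≤ ((bondT D).dist y y'' : ℝ)
  exact (mul_le_mul_of_nonneg_right hmin hMpos.le).trans key

end Gap

/-! ## §5 The cover hypotheses of Proposition 2.3 on the torus, packaged -/

section Package

variable (D : TDomains d ℓ Mh k P R)

/-- **THE COVER (2.36) OF `𝔅_T` WITH ITS CONSTANTS**, uniformly in `k`, `M_h ≥ 3`, `P_μ ≥ 5`, `D` (`R ≥ 2L`): finite overlap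
`n₀ = 3·2^{d+1}`, `cubeIndT ∈ {0,1}`, `cubeIndT·h = h`, `Σ h² = 1`, the Lipschitz bound `2s_T/M` in `d_T`, the two-level
window `jsT □ ≤ j(y) ≤ jsT □ + 1` on `□⁺`, and the gap `(1/(12L²))·M ≤ d_T(y, y″)` for `y ∉ □⁺`, `y″ ∈ supp h_□` — the
binders `hover`, `hpf01`, `hph`, `h236`, `hLip`, `hcube`, `hgap` of `B6Prop23TwoLevel.prop23_assembled_twoLevel` for the
torus geometry `geomT D`/`geomTB D` with `M = L·M_h` (the shape of the box twin `cover236_multiLevelBlocks`).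
[cite: Balaban1984PropagatorsII, (2.36) p.229, (2.70) p.235, (2.82)–(2.85) p.237, (2.46) p.231] -/
theorem cover236_multiLevelTorusBlocks (hℓ : 1 ≤ ℓ) (hMh : 3 ≤ Mh) (hR : 2 * (ℓ + 1) ≤ R) (hP5 : ∀ μ, 5 ≤ P μ)
    (hMh1 : 1 ≤ Mh) (hP4 : ∀ μ, 4 ≤ P μ) :
    (∀ y : ↥(bset D.toDomains),
      #(Finset.univ.filter fun c : ↥(cubes D.toDomains) => hB D c y ≠ 0) ≤ 3 * 2 ^ (d + 1)) ∧
    (∀ (c : ↥(cubes D.toDomains)) (y : ↥(bset D.toDomains)),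
      cubeIndT D hMh1 hP4 c y = 0 ∨ cubeIndT D hMh1 hP4 c y = 1) ∧
    (∀ (c : ↥(cubes D.toDomains)) (y : ↥(bset D.toDomains)), cubeIndT D hMh1 hP4 c y * hB D c y = hB D c y) ∧
    (∀ y : ↥(bset D.toDomains), ∑ c, hB D c y ^ 2 = 1) ∧
    (∀ (c : ↥(cubes D.toDomains)) (y y'' : ↥(bset D.toDomains)),
      |hB D c y - hB D c y''| ≤ 2 * sLipT d ℓ / (((ℓ : ℝ) + 1) * Mh) * (geomT D).dist y y'') ∧
    (∀ (c : ↥(cubes D.toDomains)) (y : ↥(bset D.toDomains)), cubeIndT D hMh1 hP4 c y ≠ 0 →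
      jsT D hMh1 hP4 c ≤ y.1.1 ∧ y.1.1 ≤ jsT D hMh1 hP4 c + 1) ∧
    (∀ (c : ↥(cubes D.toDomains)) (y y'' : ↥(bset D.toDomains)), cubeIndT D hMh1 hP4 c y = 0 → hB D c y'' ≠ 0 →
      1 / (12 * ((ℓ : ℝ) + 1) ^ 2) * (((ℓ : ℝ) + 1) * Mh) ≤ (geomT D).dist y y'') := by
  have hMh2 : 2 ≤ Mh := le_trans (by norm_num) hMh
  have hP : ∀ μ, 1 ≤ P μ := one_le_of_four_le hP4
  exact ⟨card_filter_hB_ne_zero_le D hMh1 hR hP5, cubeIndT_zero_or_one D hMh1 hP4, cubeIndT_mul_hB D hMh2 hR hMh1 hP4,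
    sum_hB_sq D hMh1 hP, abs_hB_sub_le D hℓ hMh2 hR hP5,
    fun _ _ h => hcubeT D hℓ hMh1 hR hP4 (by by_contra hq; exact h ((cubeIndT_eq_zero_iff D hMh1 hP4).2 hq)),
    fun c _ _ hy hy'' => gap_hB D hℓ hMh hR hP5 hMh1 hP4 c ((cubeIndT_eq_zero_iff D hMh1 hP4).1 hy) hy''⟩

end Package

end

end Literature.MathematicalPhysics.QuantumFieldTheory.Balaban1983to89.B6Cover236MultiLevelTorusBlocks
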